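import Literature.Probability.Percolation.HalfPlaneCrossingGluing
import HarnessLib

/-!
# Quasi-multiplicativity and extendability of the half-plane one-arm probability (bond `ℤ²`)

Topic `Literature/Probability/Percolation`; proofs only (no definition, no named fact). Sequel of
`HalfPlaneUCatch.lean` / `HalfPlaneCrossingGluing.lean` (same abstract integer coordinates `X, Y`
of `ℤ²`, same local notation; in addition `armbox[x₀, n] = {0 ≤ Y, ν[x₀, ·] ≤ n}` and
`arm[x₀, n] = openCrossing armbox[x₀, n] {x₀} {ν[x₀, ·] = n}` — the half-plane ONE-ARM EVENT from
the base point `x₀` to half-plane distance `n`; for the axis coordinates and `x₀ = 0` this is the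
event of the crux `HalfPlaneOneArmThird` of `CardyFormulaZ2`).

The separation-free case `j = 1` of Nolin's quasi-multiplicativity and extendability of arm events
NEAR A BOUNDARY (P. Nolin, EJP 13 (2008), §4.6 "Arms in the half-plane": "the extendability
property, as well as the quasi-multiplicativity" hold for the events `B_{j,σ}(n, N)`; §4.5,
Props. 12–13, 16–17 [arXiv 0711.4948: Props. 11–12, 15–16]; footnote: "in the case of one arm, …
direct consequences of RSW"; H. Kesten, CMP 109 (1987), §2), for bond percolation on `ℤ²`, in both
orientations at once, with constants INDEPENDENT OF THE SCALES:

* `arm_anti`, `real_arm_anti` — first exit: `P(arm[x₀, n]) ≤ P(arm[x₀, m])` for `0 ≤ m ≤ n`;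
* `arm_subset_arm_inter_E`, `real_arm_le_mul` — **upper half**:
  `P(arm[x₀, R]) ≤ P(arm[x₀, r]) · P(E[z₀, r + 2, R - 1])` (independence of disjoint blocks);
* `mem_arm_of_glue`, `real_arm_ge_mul` — **lower half**:
  `c · P(arm[x₀, r']) · P(E[z₀, r, R']) ≤ P(arm[x₀, R' - 1])` (gluing through a U, Harris–FKG);
* `real_arm_extend` — extendability `c · P(arm[x₀, n]) ≤ P(arm[x₀, n'])`, `n ≤ n' ≤ 3n`.

The RSW inputs are the hypotheses `RSW_LR[p]`, `RSW_TB[p]` of `HalfPlaneCrossingGluing.lean`.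
-/

noncomputable section

namespace Literature.Probability.Percolation

open MeasureTheory Set LatticeModels

namespace HalfPlaneArm

variable {F : Type*} {emb : RhombicEmbedding (zdGraph 2) F} {κ : ℝ} {X Y : Site 2 → ℤ}

local notation3 "ν[" b ", " v "]" => max |X v - X b| (Y v - Y b)
local notation3 "box[" A₁ ", " A₂ ", " B₁ ", " B₂ "]" =>
  {v : Site 2 | A₁ ≤ X v ∧ X v ≤ A₂ ∧ B₁ ≤ Y v ∧ Y v ≤ B₂}
local notation3 "LR[" A₁ ", " A₂ ", " B₁ ", " B₂ "]" =>
  openCrossing box[A₁, A₂, B₁, B₂] {v : Site 2 | X v = A₁} {v : Site 2 | X v = A₂}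
local notation3 "TB[" A₁ ", " A₂ ", " B₁ ", " B₂ "]" =>
  openCrossing box[A₁, A₂, B₁, B₂] {v : Site 2 | Y v = B₁} {v : Site 2 | Y v = B₂}
local notation3 "LRf[" A ", " B ", " w ", " h "]" =>
  openCrossing {v : Site 2 | A - 2 ≤ X v ∧ X v ≤ A + w + 2 ∧ B ≤ Y v ∧ Y v ≤ B + h}
    {v : Site 2 | X v ≤ A} {v : Site 2 | A + w ≤ X v}
local notation3 "TBf[" A ", " B ", " w ", " h "]" =>
  openCrossing {v : Site 2 | A ≤ X v ∧ X v ≤ A + w ∧ B - 2 ≤ Y v ∧ Y v ≤ B + h + 2}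
    {v : Site 2 | Y v ≤ B} {v : Site 2 | B + h ≤ Y v}
local notation3 "ann[" b ", " r ", " R "]" =>
  {v : Site 2 | 0 ≤ Y v ∧ r ≤ ν[b, v] ∧ ν[b, v] ≤ R}
local notation3 "E[" b ", " r ", " R "]" =>
  openCrossing ann[b, r, R] {v : Site 2 | ν[b, v] = r} {v : Site 2 | ν[b, v] = R}
local notation3 "Ubox[" b ", " a "]" => box[X b - 2 * a, X b + 2 * a, 0, Y b + 2 * a]
local notation3 "U[" b ", " a "]" =>
  TB[X b + a, X b + 2 * a, 0, Y b + 2 * a] ∩ LR[X b - 2 * a, X b + 2 * a, Y b + a, Y b + 2 * a] ∩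
    TB[X b - 2 * a, X b - a, 0, Y b + 2 * a]
local notation3 "μ[" p "]" => bondPercolation (zdGraph 2) p
local notation3 "RSW_LR[" p "]" => ∀ k : ℕ, 2 ≤ k → ∃ c : ℝ, 0 < c ∧ ∃ m₀ : ℕ, ∀ m : ℕ, m₀ ≤ m →
  ∀ A B : ℤ, c ≤ (bondPercolation (zdGraph 2) p).real LRf[A, B, (k : ℤ) * m, (m : ℤ)]
local notation3 "RSW_TB[" p "]" => ∀ k : ℕ, 2 ≤ k → ∃ c : ℝ, 0 < c ∧ ∃ m₀ : ℕ, ∀ m : ℕ, m₀ ≤ m →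
  ∀ A B : ℤ, c ≤ (bondPercolation (zdGraph 2) p).real TBf[A, B, (m : ℤ), (k : ℤ) * m]
local notation3 "armbox[" x ", " n "]" => {v : Site 2 | 0 ≤ Y v ∧ ν[x, v] ≤ n}
local notation3 "arm[" x ", " n "]" => openCrossing armbox[x, n] {x} {v : Site 2 | ν[x, v] = n}

/-! ### The half-plane one-arm event and its monotonicity -/

/-- Comparison of the half-plane norms seen from two neighbouring base points. [folklore] -/
theorem norm_le_norm_add_one {x₀ z₀ : Site 2} (hX0 : |X x₀ - X z₀| ≤ 1) (hY0 : |Y x₀ - Y z₀| ≤ 1)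
    (v : Site 2) : ν[z₀, v] ≤ ν[x₀, v] + 1 := by
  rw [abs_le] at hX0 hY0
  have h1 : |X v - X x₀| ≤ ν[x₀, v] := le_max_left _ _
  have h2 : Y v - Y x₀ ≤ ν[x₀, v] := le_max_right _ _
  rw [abs_le] at h1
  refine max_le ?_ (by omega)
  rw [abs_le]; constructor <;> omega

/-- The norm of the base point itself is `0` (for a base point of the half-plane). [folklore] -/
theorem norm_self (x₀ : Site 2) : ν[x₀, x₀] = 0 := by simp

section Arm

variable (hX : ∀ u v, (zdGraph 2).Adj u v → X v ≤ X u + 1) (hY : ∀ u v, (zdGraph 2).Adj u v → Y v ≤ Y u + 1)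
  (hInj : Function.Injective fun v : Site 2 => (X v, Y v))
  (hiso : emb.IsIsoradial) (hrh : emb.IsRhombicTiling) (hκ : 0 < κ)
  (hre : ∀ v, (emb.z v).re = κ * X v) (him : ∀ v, (emb.z v).im = κ * Y v)

include hInj in
/-- The half-box `armbox[x₀, n]` is finite. [folklore] -/
theorem armbox_finite (x₀ : Site 2) (n : ℤ) : (armbox[x₀, n]).Finite := by
  refine (box_finite hInj (X x₀ - n) (X x₀ + n) 0 (Y x₀ + n)).subset fun v hv => ?_
  obtain ⟨h0, hn⟩ := hv
  rw [max_le_iff, abs_le] at hn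
  exact ⟨by omega, by omega, h0, by omega⟩

include hX hY in
/-- **First exit: the one-arm event is decreasing in the distance.** On a lattice configuration,
an open path of the half-plane from `x₀` to `{ν[x₀, ·] = n}` inside `{ν[x₀, ·] ≤ n}` contains one to
`{ν[x₀, ·] = m}` inside `{ν[x₀, ·] ≤ m}` for every `0 ≤ m ≤ n` (stop at the first visit to the level
`m` of the `1`-Lipschitz norm). [folklore] -/
theorem arm_anti {ω : BondConfig (Site 2)} (hω : ω ⊆ (zdGraph 2).edgeSet) {x₀ : Site 2}
    {m n : ℤ} (hm : 0 ≤ m) (hmn : m ≤ n) (h : ω ∈ arm[x₀, n]) : ω ∈ arm[x₀, m] := by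
  obtain ⟨x, hx, y, hy, hxy⟩ := h
  rw [mem_singleton_iff] at hx
  subst hx
  have hy : ν[x, y] = n := hy
  obtain ⟨z, hz, hconn⟩ := exists_openConnIn_le_level hω (fun v => ν[x, v]) (norm_le_of_adj hX hY x) m
    (by rw [norm_self]; exact hm) (hmn.trans hy.ge) hxy
  refine ⟨x, mem_singleton _, z, hz, openConnIn_mono ?_ _ _ hconn⟩
  exact fun v hv => ⟨hv.1.1, hv.2⟩

include hX hY in
/-- `P(arm[x₀, n]) ≤ P(arm[x₀, m])` for `0 ≤ m ≤ n`. [folklore] -/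
theorem real_arm_anti (p : unitInterval) (x₀ : Site 2) {m n : ℤ} (hm : 0 ≤ m) (hmn : m ≤ n) :
    (μ[p]).real arm[x₀, n] ≤ (μ[p]).real arm[x₀, m] := by
  refine ENNReal.toReal_mono (measure_ne_top _ _) (measure_mono_ae ?_)
  filter_upwards [ae_subset_edgeSet (zdGraph 2) p] with ω hω h
  exact arm_anti hX hY hω hm hmn h

/-! ### Quasi-multiplicativity, upper half: independence of disjoint blocks -/

include hX hY in
/-- **The arm contains an inner arm and a block crossing.** On a lattice configuration, an open
path of the half-plane from `x₀` to `{ν[x₀, ·] = R}` inside `{ν[x₀, ·] ≤ R}` contains an arm to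
`{ν[x₀, ·] = r}` and, for a neighbouring centre `z₀`, an open crossing of the half-annulus
`ann[z₀, r + 2, R - 1]` (`0 ≤ r`, `r + 3 ≤ R`). [cite: Nolin2008, §4.5, Prop. 12 (ii) (arXiv 0711.4948: Prop. 11), with §4.6] -/
theorem arm_subset_arm_inter_E {ω : BondConfig (Site 2)} (hω : ω ⊆ (zdGraph 2).edgeSet)
    {x₀ z₀ : Site 2} (hX0 : |X x₀ - X z₀| ≤ 1) (hY0 : |Y x₀ - Y z₀| ≤ 1) {r R : ℤ} (hr : 0 ≤ r)
    (hrR : r + 3 ≤ R) (h : ω ∈ arm[x₀, R]) : ω ∈ arm[x₀, r] ∩ E[z₀, r + 2, R - 1] := by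
  refine ⟨arm_anti hX hY hω hr (by omega) h, ?_⟩
  obtain ⟨x, hx, y, hy, hxy⟩ := h
  rw [mem_singleton_iff] at hx
  subst hx
  have hy : ν[x, y] = R := hy
  have hX0' : |X z₀ - X x| ≤ 1 := by rw [abs_sub_comm]; exact hX0
  have hY0' : |Y z₀ - Y x| ≤ 1 := by rw [abs_sub_comm]; exact hY0
  have h1 : ν[z₀, x] ≤ r + 2 := by
    have := norm_le_norm_add_one hX0 hY0 x
    rw [norm_self] at this; omega
  have h2 : R - 1 ≤ ν[z₀, y] := by
    have := norm_le_norm_add_one hX0' hY0' y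
    omega
  obtain ⟨x', y', hx', hy', hconn⟩ := exists_openConnIn_clip hω (fun v => ν[z₀, v])
    (norm_le_of_adj hX hY z₀) (a := r + 2) (b := R - 1) (by omega) h1 h2 hxy
  refine ⟨x', hx', y', hy', openConnIn_mono ?_ _ _ hconn⟩
  exact fun v hv => ⟨hv.1.1, hv.2.1, hv.2.2⟩

/-- Pairs of sites of two disjoint regions are disjoint sets of pairs. [folklore] -/
theorem disjoint_pairs {S T : Set (Site 2)} (h : Disjoint S T) :
    Disjoint {e : Sym2 (Site 2) | ∀ x ∈ e, x ∈ S} {e : Sym2 (Site 2) | ∀ x ∈ e, x ∈ T} := by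
  rw [Set.disjoint_left]
  intro e heS heT
  induction e using Sym2.ind with
  | h a b => exact Set.disjoint_left.1 h (heS a (Sym2.mem_mk_left a b)) (heT a (Sym2.mem_mk_left a b))

include hX hY hInj in
/-- **Quasi-multiplicativity of the half-plane one-arm probability, upper half** (Nolin 2008,
Prop. 12 (ii) / proof of Prop. 13, separation-free case of one arm; Kesten 1987, §2):
`P(arm[x₀, R]) ≤ P(arm[x₀, r]) · P(E[z₀, r + 2, R - 1])` for `0 ≤ r`, `r + 3 ≤ R` and a centre `z₀`
of the block within one unit of `x₀` in each coordinate — the inner arm and the block crossing of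
`arm_subset_arm_inter_E` are determined by disjoint sets of edges, hence independent under the
product measure. [cite: Nolin2008, §4.5, Props. 12–13 (arXiv 0711.4948: Props. 11–12), with §4.6] -/
theorem real_arm_le_mul (p : unitInterval) {x₀ z₀ : Site 2} (hX0 : |X x₀ - X z₀| ≤ 1)
    (hY0 : |Y x₀ - Y z₀| ≤ 1) {r R : ℤ} (hr : 0 ≤ r) (hrR : r + 3 ≤ R) :
    (μ[p]).real arm[x₀, R] ≤ (μ[p]).real arm[x₀, r] * (μ[p]).real E[z₀, r + 2, R - 1] := by
  have hdisj : Disjoint (armbox[x₀, r]) (ann[z₀, r + 2, R - 1]) := by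
    rw [Set.disjoint_left]
    rintro v ⟨-, hv⟩ ⟨-, hv', -⟩
    have := norm_le_norm_add_one hX0 hY0 v
    omega
  rw [← bondPercolation_real_inter_of_disjoint (zdGraph 2) p (disjoint_pairs hdisj)
    (determinedBy_openCrossing_of_finite (armbox_finite hInj x₀ r) _ _)
    (determinedBy_openCrossing_of_finite (ann_finite hInj z₀ (r + 2) (R - 1)) _ _)
    (measurableSet_openCrossing_of_finite (armbox_finite hInj x₀ r) _ _)
    (measurableSet_openCrossing_of_finite (ann_finite hInj z₀ (r + 2) (R - 1)) _ _)]
  refine ENNReal.toReal_mono (measure_ne_top _ _) (measure_mono_ae ?_)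
  filter_upwards [ae_subset_edgeSet (zdGraph 2) p] with ω hω h
  exact arm_subset_arm_inter_E hX hY hω hX0 hY0 hr hrR h

/-! ### Quasi-multiplicativity, lower half: gluing through a U -/

include hX hY hiso hrh hκ hre him in
/-- **Gluing an arm and a block crossing** (deterministic): on a lattice configuration in
`arm[x₀, r'] ∩ U[x₀, a] ∩ E[z₀, r, R']` with `1 ≤ a`, `Y x₀ ≥ 0`, `r + 1 ≤ a ≤ r'/2`,
`2a + 1 ≤ R'` and `z₀` within one unit of `x₀`, the arm and the block crossing both run from
`ν[x₀, ·] ≤ a` to `ν[x₀, ·] ≥ 2a`, so the U joins them (`glue`), and the open path from `x₀` to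
`{ν[x₀, ·] ≥ R' - 1}` obtained is stopped at its first visit to `{ν[x₀, ·] = R' - 1}`: the
configuration lies in `arm[x₀, R' - 1]`. [cite: Nolin2008, §4.3, proof of Prop. 12 (i) (arXiv 0711.4948: Prop. 11), with §4.6] -/
theorem mem_arm_of_glue {ω : BondConfig (Site 2)} (hω : ω ⊆ (zdGraph 2).edgeSet) {x₀ z₀ : Site 2}
    (hx₀ : 0 ≤ Y x₀) (hX0 : |X x₀ - X z₀| ≤ 1) (hY0 : |Y x₀ - Y z₀| ≤ 1) {a r r' R' : ℤ}
    (ha : 1 ≤ a) (hra : r + 1 ≤ a) (har' : 2 * a ≤ r') (haR' : 2 * a + 1 ≤ R')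
    (h1 : ω ∈ arm[x₀, r']) (h2 : ω ∈ U[x₀, a]) (h3 : ω ∈ E[z₀, r, R']) : ω ∈ arm[x₀, R' - 1] := by
  obtain ⟨x, hx, y, hy, hxy⟩ := h1
  rw [mem_singleton_iff] at hx
  subst hx
  have hy : ν[x, y] = r' := hy
  obtain ⟨x', hx', y', hy', hxy'⟩ := h3
  have hx' : ν[z₀, x'] = r := hx'
  have hy' : ν[z₀, y'] = R' := hy'
  have hX0' : |X z₀ - X x| ≤ 1 := by rw [abs_sub_comm]; exact hX0
  have hY0' : |Y z₀ - Y x| ≤ 1 := by rw [abs_sub_comm]; exact hY0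
  have e1 : ν[x, x'] ≤ a := by have := norm_le_norm_add_one hX0' hY0' x'; omega
  have e3 : R' - 1 ≤ ν[x, y'] := by have := norm_le_norm_add_one hX0 hY0 y'; omega
  have e2 : 2 * a ≤ ν[x, y'] := by omega
  have g := glue hX hY hiso hrh hκ hre him hω hx₀ ha h2 (S := armbox[x, r']) (fun v hv => hv.1) hxy
    (by rw [norm_self]; omega) (by omega) (S' := ann[z₀, r, R']) (fun v hv => hv.1) hxy' e1 e2
  have hW : armbox[x, r'] ∪ ann[z₀, r, R'] ∪ Ubox[x, a] ⊆ {v : Site 2 | 0 ≤ Y v} := by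
    rintro v ((hv | hv) | hv)
    exacts [hv.1, hv.1, hv.2.2.1]
  have g' : ω ∈ openConnIn {v : Site 2 | 0 ≤ Y v} x y' :=
    conn_trans hW (fun v hv => hW (Or.inl (Or.inr hv))) g hxy'
  obtain ⟨z, hz, hconn⟩ := exists_openConnIn_le_level hω (fun v => ν[x, v]) (norm_le_of_adj hX hY x)
    (R' - 1) (by rw [norm_self]; omega) e3 g'
  refine ⟨x, mem_singleton _, z, hz, openConnIn_mono ?_ _ _ hconn⟩
  exact fun v hv => ⟨hv.1, hv.2⟩

include hX hY hInj hiso hrh hκ hre him in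
/-- **Quasi-multiplicativity of the half-plane one-arm probability, lower half** (Nolin 2008,
Prop. 13 for one arm via the proof of Prop. 12 (i), half-plane version of §4.6; Kesten 1987, §2):
there are `c > 0` and `m₀` such that
`c · P(arm[x₀, r']) · P(E[z₀, r, R']) ≤ P(arm[x₀, R' - 1])` whenever `m₀ ⊔ Y x₀ ≤ a`, `0 ≤ r`,
`r + 1 ≤ a`, `2a ≤ r'`, `2a + 1 ≤ R'` and `z₀` is within one unit of `x₀` (Harris–FKG with the U of
`real_U_ge` and the deterministic `mem_arm_of_glue`); `c` does not depend on the scales.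
[cite: Nolin2008, §4.5, Props. 12–13 (arXiv 0711.4948: Props. 11–12), with §4.6] -/
theorem real_arm_ge_mul (p : unitInterval) (rswLR : RSW_LR[p]) (rswTB : RSW_TB[p]) :
    ∃ c : ℝ, 0 < c ∧ ∃ m₀ : ℕ, ∀ (x₀ z₀ : Site 2) (a r r' R' : ℤ), 0 ≤ Y x₀ → |X x₀ - X z₀| ≤ 1 →
      |Y x₀ - Y z₀| ≤ 1 → (m₀ : ℤ) ≤ a → Y x₀ ≤ a → 0 ≤ r → r + 1 ≤ a → 2 * a ≤ r' → 2 * a + 1 ≤ R' →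
      c * (μ[p]).real arm[x₀, r'] * (μ[p]).real E[z₀, r, R'] ≤ (μ[p]).real arm[x₀, R' - 1] := by
  obtain ⟨cU, hcU, mU, hU⟩ := real_U_ge hX hY hInj p rswLR rswTB
  refine ⟨cU, hcU, mU + 1, fun x₀ z₀ a r r' R' hx₀ hX0 hY0 hma hxa hr hra har' haR' => ?_⟩
  have eU := hU x₀ a hx₀ (by push_cast at hma; omega) hxa
  have mA : MeasurableSet (arm[x₀, r']) := measurableSet_openCrossing_of_finite (armbox_finite hInj x₀ r') _ _
  have mE : MeasurableSet (E[z₀, r, R']) := measurableSet_openCrossing_of_finite (ann_finite hInj z₀ r R') _ _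
  have finB := box_finite hInj
  have mU' : MeasurableSet (U[x₀, a]) :=
    ((measurableSet_openCrossing_of_finite (finB _ _ _ _) _ _).inter
      (measurableSet_openCrossing_of_finite (finB _ _ _ _) _ _)).inter
      (measurableSet_openCrossing_of_finite (finB _ _ _ _) _ _)
  have uU : IsUpperSet (U[x₀, a]) :=
    ((isUpperSet_openCrossing _ _ _).inter (isUpperSet_openCrossing _ _ _)).inter
      (isUpperSet_openCrossing _ _ _)
  have hsub : (μ[p]).real (arm[x₀, r'] ∩ U[x₀, a] ∩ E[z₀, r, R']) ≤ (μ[p]).real arm[x₀, R' - 1] := by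
    refine ENNReal.toReal_mono (measure_ne_top _ _) (measure_mono_ae ?_)
    filter_upwards [ae_subset_edgeSet (zdGraph 2) p] with ω hω h
    exact mem_arm_of_glue hX hY hiso hrh hκ hre him hω hx₀ hX0 hY0 (by push_cast at hma; omega) hra
      har' haR' h.1.1 h.1.2 h.2
  calc cU * (μ[p]).real arm[x₀, r'] * (μ[p]).real E[z₀, r, R']
      = (μ[p]).real arm[x₀, r'] * cU * (μ[p]).real E[z₀, r, R'] := by ring
    _ ≤ (μ[p]).real arm[x₀, r'] * (μ[p]).real U[x₀, a] * (μ[p]).real E[z₀, r, R'] := by gcongr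
    _ ≤ _ := harris₃ p (isUpperSet_openCrossing _ _ _) uU (isUpperSet_openCrossing _ _ _) mA mU' mE
    _ ≤ _ := hsub

include hX hY hInj hiso hrh hκ hre him in
/-- **Extendability of the half-plane arm** (Nolin 2008, Prop. 12 (i) for one arm; Werner 2009,
Lecture 3): there are `c > 0` and `m₀` with `c · P(arm[x₀, n]) ≤ P(arm[x₀, n'])` for all
`m₀ ≤ n ≤ n' ≤ 3n` and base points with `0 ≤ Y x₀ ≤ 1` (`real_arm_ge_mul` with the block crossing
of `ann[x₀, n/2 - 1, n' + 1]`, whose probability is bounded below by `crossing_lower`).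
[cite: Nolin2008, §4.5, Prop. 12 (i) (arXiv 0711.4948: Prop. 11), with §4.6] -/
theorem real_arm_extend (p : unitInterval) (rswLR : RSW_LR[p]) (rswTB : RSW_TB[p]) :
    ∃ c : ℝ, 0 < c ∧ ∃ m₀ : ℕ, ∀ (x₀ : Site 2) (n n' : ℤ), 0 ≤ Y x₀ → Y x₀ ≤ 1 → (m₀ : ℤ) ≤ n →
      n ≤ n' → n' ≤ 3 * n → c * (μ[p]).real arm[x₀, n] ≤ (μ[p]).real arm[x₀, n'] := by
  obtain ⟨cA, hcA, mA, hA⟩ := real_arm_ge_mul hX hY hInj hiso hrh hκ hre him p rswLR rswTB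
  obtain ⟨c8, hc8, m8, h8⟩ := crossing_lower hX p rswLR 8
  refine ⟨cA * c8, by positivity, 2 * max mA m8 + 20, fun x₀ n n' hx₀ hx₁ hn hnn' hn' => ?_⟩
  have hm : ((2 * max mA m8 + 20 : ℕ) : ℤ) = 2 * max (mA : ℤ) (m8 : ℤ) + 20 := by push_cast; rfl
  rw [hm] at hn
  have hmA : (mA : ℤ) ≤ max (mA : ℤ) (m8 : ℤ) := le_max_left _ _
  have hm8 : (m8 : ℤ) ≤ max (mA : ℤ) (m8 : ℤ) := le_max_right _ _
  have h2a : 2 * (n / 2) ≤ n := Int.mul_ediv_self_le (by norm_num)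
  have h2a' : n < 2 * (n / 2) + 2 := by omega
  have key := hA x₀ x₀ (n / 2) (n / 2 - 1) n (n' + 1) hx₀ (by simp) (by simp) (by omega) (by omega)
    (by omega) (by omega) (by omega) (by omega)
  have eE := h8 x₀ (n / 2 - 1) (n' + 1) hx₀ (by omega) (by omega) (by push_cast; omega)
  rw [add_sub_cancel_right] at key
  calc cA * c8 * (μ[p]).real arm[x₀, n] = cA * (μ[p]).real arm[x₀, n] * c8 := by ring
    _ ≤ cA * (μ[p]).real arm[x₀, n] * (μ[p]).real E[x₀, n / 2 - 1, n' + 1] := by gcongr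
    _ ≤ _ := key

end Arm

end HalfPlaneArm

end Literature.Probability.Percolation
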